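import Literature.Computability.AlgebraicComplexity.IntegerPolynomialGoodPrime
import Literature.Computability.AlgebraicComplexity.ConstantFreeValiant
import HarnessLib

/-!
# One good prime of polynomial bit-length for a whole `VP⁰` family

The «good prime by counting» engine `IntegerPolynomialGoodPrime.lean`
(`MvPolynomial.exists_prime_forall_map_zmod_ne_zero`: one prime `p > M`, of bit-length
`2·log₂(M + Σ T_i + 3) + 6`, with `D_i mod p ≠ 0` for a finite family of nonzero integer
polynomials of weights `wt(D_i) ≤ 2^{T_i}`) packaged in the currency of the tree's constant-free
class `IsVP0Family` (`ConstantFreeValiant.lean`): for a `VP⁰` family `(D_n)` of NONZERO integer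
polynomials and any threshold `M(n)` of polynomially bounded bit-length there is a polynomially
bounded `q` such that for every `n` some prime `M(n) < p < 2^{q(n)}` has `D_k mod p ≠ 0` for ALL
`k ≤ n` (`IsVP0Family.exists_prime_forall_map_zmod_ne_zero`). The weights come from the size
bound alone: a fan-in-two sign-constant circuit of size `s` computes a polynomial of weight
`≤ 2^{2^s}` (`weight_eval_le_two_pow_two_pow_size`, the size form of Bürgisser 2000 TCS Lemma 2.4) —
no formal-degree or height hypothesis is used, which matters because the tree's `IsVP0Family`
(fan-in AT MOST two; empty gates have formal degree `0`) admits coefficients of height `2^{2^n}`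
(`VP0EmptyGateConstants.lean`), so no bound `Σ|coeff| ≤ 2^{poly(n)}` is available for it.

This is the «∀ n ∃ p of poly(n) bits, M(n) < p, ∀ k ≤ n, D_k mod p ≠ 0» step of the val-lit route
of record to BIJL18 Thm. 6 (memo `MEMO-p1g6-BIJL18-thm6-route.md`, STATUS block: the guessed
prime must make every natural proof `D_k`, `k ≤ n`, survive reduction mod `p`). Theorem-only; no
definitions, no named facts. Honest framing: elementary counting; nothing here bears on
`VP ≠ VNP`, which is NOT proved.

## References

* [Burgisser2000TCS] P. Bürgisser, *Cook's versus Valiant's hypothesis*, Theoret. Comput. Sci.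
  235 (2000), Lemma 2.4 p. 77 (weight of a circuit's value) and §4 p. 79 (reduction modulo primes).
* [HardyWright2008] G. H. Hardy, E. M. Wright, *An Introduction to the Theory of Numbers*, 6th ed.,
  Thm. 414 (Chebyshev bounds) and §22.10 (number of prime divisors).
* [Burgisser2006] P. Bürgisser, ECCC TR06-113 = Comput. Complexity 18 (2009), Def. 2.7 (`VP⁰`).
-/

namespace Literature.Computability.AlgebraicComplexity

open MvPolynomial

universe v

variable {σ : ℕ → Type v} [∀ n, Fintype (σ n)]

/-- The circuits of a `VP⁰` family bound the weights: `wt(D_k) ≤ 2^{2^{k^a + a}}` for the size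
exponent `a`. [cite: Burgisser2000TCS, Lemma 2.4 p. 77] -/
theorem IsVP0Family.exists_weight_le_two_pow_two_pow {D : ∀ n, MvPolynomial (σ n) ℤ}
    (hD : IsVP0Family D) : ∃ a : ℕ, ∀ k, weight (D k) ≤ 2 ^ 2 ^ (k ^ a + a) := by
  obtain ⟨-, C, hC, ⟨a, ha⟩, -⟩ := hD
  refine ⟨a, fun k => ?_⟩
  obtain ⟨h2, hsc, hcomp⟩ := hC k
  rw [ArithCircuit.Computes] at hcomp
  rw [← hcomp]
  exact (weight_eval_le_two_pow_two_pow_size h2 hsc).trans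
    (Nat.pow_le_pow_right two_pos (Nat.pow_le_pow_right two_pos (ha k)))

/-- **One good prime of polynomial bit-length for a whole `VP⁰` family.** If `(D_n)` is a `VP⁰`
family (tree sense: fan-in at most two, sign constants, p-bounded size and formal degree) of
NONZERO integer polynomials and the thresholds `M(n)` have p-bounded bit-length `log₂ M(n)`, then
for some p-bounded `q` and every `n` there is a prime `p` with `M(n) < p < 2^{q(n)}` such that
`D_k mod p ≠ 0` in `𝔽_p[x]` for every `k ≤ n`: apply the counting lemma
`MvPolynomial.exists_prime_forall_map_zmod_ne_zero` to `D_0, …, D_n` with the weight exponents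
`T_k = 2^{k^a + a}` of `IsVP0Family.exists_weight_le_two_pow_two_pow`; the bit-length
`2·log₂(M(n) + Σ_{k ≤ n} 2^{k^a+a} + 3) + 6 ≤ 2·(log₂ M(n) + n + n^a + a + 4) + 6` is p-bounded.
[cite: Burgisser2000TCS, Lemma 2.4 p. 77 and §4 p. 79] [cite: HardyWright2008, Thm. 414 and §22.10] -/
theorem IsVP0Family.exists_prime_forall_map_zmod_ne_zero {D : ∀ n, MvPolynomial (σ n) ℤ}
    (hD : IsVP0Family D) (h0 : ∀ n, D n ≠ 0) {M : ℕ → ℕ}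
    (hM : IsPBounded fun n => Nat.log 2 (M n)) :
    ∃ q : ℕ → ℕ, IsPBounded q ∧ ∀ n, ∃ p : ℕ, p.Prime ∧ M n < p ∧ p < 2 ^ q n ∧
      ∀ k ≤ n, MvPolynomial.map (Int.castRingHom (ZMod p)) (D k) ≠ 0 := by
  obtain ⟨a, hwt⟩ := hD.exists_weight_le_two_pow_two_pow
  obtain ⟨b, hb⟩ := hM
  refine ⟨fun n => 2 * Nat.log 2 (M n + (∑ k ∈ Finset.range (n + 1), 2 ^ (k ^ a + a)) + 3) + 6,
    ?_, fun n => ?_⟩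
  · -- the bit-length is p-bounded
    have hpb : IsPBounded fun n => 2 * ((n ^ b + b + 1) + (n + (n ^ a + a)) + 2) + 6 :=
      IsPBounded.add_holds (IsPBounded.mul_holds (IsPBounded.const 2)
        (IsPBounded.add_holds (IsPBounded.add_holds
          (IsPBounded.add_holds ⟨b, fun n => le_rfl⟩ (IsPBounded.const 1))
          (IsPBounded.add_holds ⟨1, fun n => by simp⟩ ⟨a, fun n => le_rfl⟩)) (IsPBounded.const 2)))
        (IsPBounded.const 6)
    refine hpb.mono fun n => ?_
    set S := ∑ k ∈ Finset.range (n + 1), 2 ^ (k ^ a + a) with hS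
    set P := n ^ b + b + 1 with hPdef
    set Q := n + (n ^ a + a) with hQdef
    show 2 * Nat.log 2 (M n + S + 3) + 6 ≤ 2 * (P + Q + 2) + 6
    have hP : M n < 2 ^ P :=
      (Nat.lt_pow_succ_log_self one_lt_two (M n)).trans_le
        (Nat.pow_le_pow_right two_pos (by have := hb n; simp only at this; omega))
    have hQ : S ≤ 2 ^ Q :=
      calc S ≤ ∑ k ∈ Finset.range (n + 1), 2 ^ (n ^ a + a) :=
            Finset.sum_le_sum fun k hk => Nat.pow_le_pow_right two_pos
              (Nat.add_le_add_right (Nat.pow_le_pow_left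
                (Nat.lt_succ_iff.mp (Finset.mem_range.mp hk)) a) a)
        _ = (n + 1) * 2 ^ (n ^ a + a) := by simp [Finset.sum_const, Finset.card_range]
        _ ≤ 2 ^ n * 2 ^ (n ^ a + a) :=
            Nat.mul_le_mul_right _ (Nat.succ_le_of_lt Nat.lt_two_pow_self)
        _ = 2 ^ Q := (pow_add 2 n _).symm
    have h1 : 2 ^ P ≤ 2 ^ (P + Q + 1) := Nat.pow_le_pow_right two_pos (by omega)
    have h2 : 2 ^ Q ≤ 2 ^ (P + Q + 1) := Nat.pow_le_pow_right two_pos (by omega)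
    have h3 : 4 ≤ 2 ^ (P + Q + 1) :=
      calc (4 : ℕ) = 2 ^ 2 := by norm_num
        _ ≤ 2 ^ (P + Q + 1) := Nat.pow_le_pow_right two_pos (by omega)
    have h4 : 2 ^ (P + Q + 3) = 4 * 2 ^ (P + Q + 1) := by ring
    have hX : M n + S + 3 < 2 ^ (P + Q + 3) := by omega
    have hlog : Nat.log 2 (M n + S + 3) < P + Q + 3 := Nat.log_lt_of_lt_pow (by omega) hX
    omega
  · -- the prime
    obtain ⟨p, hp, hMp, hpK, hne⟩ := MvPolynomial.exists_prime_forall_map_zmod_ne_zero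
      (Finset.range (n + 1)) D (T := fun k => 2 ^ (k ^ a + a)) (fun k _ => h0 k)
      (fun k _ => hwt k) (M n)
    exact ⟨p, hp, hMp, hpK, fun k hk => hne k (Finset.mem_range.2 (Nat.lt_succ_of_le hk))⟩

end Literature.Computability.AlgebraicComplexity
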